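import Literature.AlgebraicGeometry.Motives.ProjFamilySpecialization
import Literature.AlgebraicGeometry.Motives.LinesInProjectiveSpace
import Literature.AlgebraicGeometry.Motives.LinesGenerateChowOneLinear
import Literature.AlgebraicGeometry.Motives.SubschemeCyclesFundamentalProofs
import Literature.LinearAlgebra.LatticeSaturation
import Mathlib.AlgebraicGeometry.AlgClosed.Basic
import Mathlib.AlgebraicGeometry.FunctionField
import HarnessLib

/-!
# Limits of lines are lines: vertical components of the closure of a line of the generic fibre

Let `k` be algebraically closed, `B` an integral `k`-scheme locally of finite type whose local
ring at a closed point `b` is a principal ideal domain (a point of a smooth curve), `K = k(B)` its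
function field, and `L ⊆ ℙᴺ_K` a line of the generic fibre of `ℙᴺ ×ₖ B → B`, cut out by `N - 1`
independent linear forms over `K`. **Every point `w` of dimension `1` of the closure of `L` in
`ℙᴺ ×ₖ B` lying over `b` is a line of `ℙᴺ_k`**: the closure of `pr₁ w` is `V₊(L̄₁, …, L̄_{N-1})`
for independent linear forms `L̄ᵢ` over `k` (`exists_line_of_vertical`). This is the geometric
input "limits of lines are lines" of the ruled-surface step in Tian–Zong, *One-cycles on
rationally connected varieties* (Compositio Math. 150 (2014)), proofs of Prop. 3.1 / Prop. 7.2
("the chain of lines … is equivalent to a chain of ruled surfaces over `C`"; the fibres of these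
surfaces are lines), i.e. the valuative criterion for the Grassmannian in coordinates.

Proof. The `K`-span of the `N - 1` forms has, by the Smith normal form over the discrete valuation
ring `𝒪_{B,b}` (`Literature.LinearAlgebra.exists_integral_basis_linearIndependent_quotient`), a basis
of forms with coefficients in `𝒪_{B,b}` whose reductions modulo `𝔪_b` are independent; clearing a
common denominator regular and non-vanishing at `b` (Mathlib `IsLocalization.exist_integer_multiples`
for `Γ(U) → 𝒪_{B,b}`, `U` an affine neighbourhood) gives forms over `A = Γ(B, U)`. Such a form
vanishes at the generic point of `L`, hence — `ℙᴺ × U = ℙᴺ_A` and closures are zero loci of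
homogeneous primes — its reduction at `b` vanishes at `pr₁ w`
(`ProjFamily.map_mem_asHomogeneousIdeal_of_mem_closure`, `Motives/ProjFamilySpecialization`). So
`pr₁ w ∈ V₊(L̄)`, a line; as `pr₁ w` has dimension `1` (the fibre over `b` is a closed copy of
`ℙᴺ_k`, `ProjFamily.isClosedImmersion_slice`), it is the generic point of that line
(`height_lt_of_mem_zeroLocus`, `Motives/LinesInProjectiveSpace`).

Everything is proved; no named facts.

## References

* [TianZong2014] Z. Tian, H. R. Zong, *One-cycles on rationally connected varieties*, Compositio
  Math. 150 (2014), proofs of Prop. 3.1 and Prop. 7.2.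
* [Fulton1998] W. Fulton, *Intersection Theory*, §10.1 (families of cycles over a curve).
-/

noncomputable section

open CategoryTheory CategoryTheory.Limits AlgebraicGeometry MonoidalCategory MvPolynomial
  TopologicalSpace Order

universe u

namespace Literature.AlgebraicGeometry.Motives

attribute [local instance] MvPolynomial.gradedAlgebra MvPolynomial.algebraMvPolynomial
  Literature.AlgebraicGeometry.Motives.ProjBaseChange.algebraBase
  UniversalHyperplaneSection.sectionsAlgebra

namespace ProjFamily

open ProjBaseChangeRing ProjectiveSpaceCells

variable {k : Type u} [Field k]

/-! ### The function field as a `k`-algebra -/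

/-- The function field `k(B)` of an integral `k`-scheme `B` as a `k`-algebra:
`k = Γ(Spec k) → Γ(B, B) → 𝒪_{B,η} = k(B)`. (A file-local instance; the same formula is used
throughout the tree, e.g. `Motives/BlochSrinivasPrincipleFieldProofs`.) [folklore] -/
@[reducible]
def functionFieldAlgebra (B : SchemeOver k) [IsIntegral B.left] : Algebra k B.left.functionField :=
  ((B.left.presheaf.germ ⊤ (genericPoint B.left) trivial).hom.comp
    (B.hom.appTop.hom.comp (Scheme.ΓSpecIso (.of k)).inv.hom)).toAlgebra

attribute [local instance] functionFieldAlgebra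

/-- `k → Γ(B, U) → k(B)` is a scalar tower (both composites are "restrict the pulled-back scalar
and take its germ at the generic point"). [folklore] -/
theorem isScalarTower_sections_functionField (B : SchemeOver k) [IsIntegral B.left]
    (U : B.left.Opens) [Nonempty U] : IsScalarTower k Γ(B.left, U) B.left.functionField := by
  refine IsScalarTower.of_algebraMap_eq fun c => ?_
  change (B.left.presheaf.germ ⊤ (genericPoint B.left) trivial)
      (B.hom.appTop ((Scheme.ΓSpecIso (.of k)).inv c)) =
    B.left.germToFunctionField U (SchemeOver.scalarRingHom B U c)
  rw [SchemeOver.scalarRingHom_apply, Scheme.germToFunctionField, Scheme.Hom.appLE,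
    CommRingCat.comp_apply, TopCat.Presheaf.germ_res_apply, Scheme.Hom.appTop]
  rfl

/-- The generic point `Spec k(B) → B` factors through any non-empty affine open `U = Spec A`:
it is `Spec` of `A → k(B)` followed by `U ↪ B` (Mathlib `IsAffineOpen.fromSpecStalk_eq_fromSpecStalk`).
[folklore] -/
theorem fromSpecStalk_genericPoint_eq (B : SchemeOver k) [IsIntegral B.left] {U : B.left.Opens}
    (hU : IsAffineOpen U) [Nonempty U] :
    B.left.fromSpecStalk (genericPoint B.left) =
      Spec.map (CommRingCat.ofHom (algebraMap Γ(B.left, U) B.left.functionField)) ≫ hU.fromSpec := by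
  have hη : genericPoint B.left ∈ U :=
    ((genericPoint_spec B.left).mem_open_set_iff U.isOpen).mpr (by simpa using ‹Nonempty U›)
  rw [← hU.fromSpecStalk_eq_fromSpecStalk hη, IsAffineOpen.fromSpecStalk]
  rfl

/-! ### Evaluation at a closed point -/

section KPoint

variable [IsAlgClosed k] (B : SchemeOver k) [LocallyOfFiniteType B.hom] {U : B.left.Opens}
  (hU : IsAffineOpen U) {b : B.left} (hb : IsClosed ({b} : Set B.left)) (hbU : b ∈ U)

/-- The `k`-point `Spec k → B` at a closed point `b` (`k` algebraically closed, `B` locally of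
finite type; Mathlib `pointOfClosedPoint`). [folklore] -/
abbrev kpt : Spec (.of k) ⟶ B.left := pointOfClosedPoint B.hom b hb

include hbU in
/-- `Spec k` maps into `U` under the `k`-point at `b ∈ U`. [folklore] -/
theorem top_le_kpt_preimage : (⊤ : (Spec (.of k)).Opens) ≤ kpt B hb ⁻¹ᵁ U := by
  intro x _
  change (kpt B hb).base x ∈ U
  rw [pointOfClosedPoint_apply]
  exact hbU

/-- **Evaluation at the closed point `b`**: `Γ(B, U) → Γ(Spec k, Spec k) = k`, pull-back along
the `k`-point at `b`. [folklore] -/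
def ev : Γ(B.left, U) →+* k :=
  (Scheme.ΓSpecIso (.of k)).hom.hom.comp ((kpt B hb).appLE U ⊤ (top_le_kpt_preimage B hb hbU)).hom

/-- **Evaluation is a retraction of the scalars**: the scalar `c` takes the value `c` at `b`.
[folklore] -/
theorem ev_scalarRingHom (c : k) : ev B hb hbU (SchemeOver.scalarRingHom B U c) = c := by
  have key : ∀ (g : Spec (.of k) ⟶ Spec (.of k)) (_ : g = 𝟙 _) (e : (⊤ : (Spec (.of k)).Opens) ≤ g ⁻¹ᵁ ⊤)
      (x : Γ(Spec (.of k), ⊤)), g.appLE ⊤ ⊤ e x = x := by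
    rintro g rfl e x
    simp [Scheme.Hom.appLE]
  rw [SchemeOver.scalarRingHom_apply, ev, RingHom.comp_apply]
  change (Scheme.ΓSpecIso (.of k)).hom ((B.hom.appLE ⊤ U le_top ≫
    (kpt B hb).appLE U ⊤ (top_le_kpt_preimage B hb hbU)) ((Scheme.ΓSpecIso (.of k)).inv c)) = c
  rw [Scheme.Hom.appLE_comp_appLE, key _ (pointOfClosedPoint_comp B.hom b hb)]
  exact (Scheme.ΓSpecIso (CommRingCat.of k)).inv_hom_id_apply c

/-- Evaluation is onto `k`. [folklore] -/
theorem ev_surjective : Function.Surjective (ev B hb hbU) := fun c =>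
  ⟨SchemeOver.scalarRingHom B U c, ev_scalarRingHom B hb hbU c⟩

/-- With the `Γ(B, U)`-algebra structure on `k` given by evaluation at `b`, the point
`ProjFamily.pt` (`Spec` of the evaluation followed by `U ↪ B`) is the `k`-point at `b`.
[folklore] -/
theorem pt_eq_kpt : letI := (ev B hb hbU).toAlgebra; pt B hU = kpt B hb := by
  letI := (ev B hb hbU).toAlgebra
  have h1 := IsAffineOpen.SpecMap_appLE_fromSpec (kpt B hb) hU (isAffineOpen_top _)
    (top_le_kpt_preimage B hb hbU)
  rw [IsAffineOpen.fromSpec_top, Scheme.isoSpec_Spec_inv] at h1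
  change Spec.map (CommRingCat.ofHom (ev B hb hbU)) ≫ hU.fromSpec = _
  have hev : CommRingCat.ofHom (ev B hb hbU) =
      (kpt B hb).appLE U ⊤ (top_le_kpt_preimage B hb hbU) ≫ (Scheme.ΓSpecIso (.of k)).hom := rfl
  rw [hev, Spec.map_comp, Category.assoc, h1, ← Category.assoc, ← Spec.map_comp, Iso.inv_hom_id,
    Spec.map_id, Category.id_comp]

/-- The image of `ProjFamily.pt` is `{b}`. [folklore] -/
theorem range_pt_eq : letI := (ev B hb hbU).toAlgebra;
    Set.range (pt B hU).base = {b} := by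
  letI := (ev B hb hbU).toAlgebra
  rw [pt_eq_kpt B hU hb hbU]
  ext x
  simp only [Set.mem_range, Set.mem_singleton_iff]
  constructor
  · rintro ⟨y, rfl⟩
    exact pointOfClosedPoint_apply B.hom b hb y
  · intro hx
    rw [hx]
    exact ⟨IsLocalRing.closedPoint k, pointOfClosedPoint_apply B.hom b hb _⟩

/-- **The kernel of evaluation at `b` is the prime of `b`**: `s(b) = 0` iff `b ∉ D(s)` iff the germ
of `s` at `b` is not a unit. [folklore] -/
theorem ev_eq_zero_iff (s : Γ(B.left, U)) : ev B hb hbU s = 0 ↔ b ∉ B.left.basicOpen s := by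
  have hpre : (Spec (.of k)).basicOpen ((kpt B hb).appLE U ⊤ (top_le_kpt_preimage B hb hbU) s) =
      ⊤ ⊓ (kpt B hb) ⁻¹ᵁ B.left.basicOpen s := Scheme.basicOpen_appLE _ _ _ _ s
  have hmem : b ∈ B.left.basicOpen s ↔
      IsLocalRing.closedPoint k ∈ (Spec (.of k)).basicOpen
        ((kpt B hb).appLE U ⊤ (top_le_kpt_preimage B hb hbU) s) := by
    rw [hpre]
    change _ ↔ _ ∈ ((⊤ : (Spec (.of k)).Opens) : Set _) ∩ (kpt B hb).base ⁻¹' (B.left.basicOpen s : Set _)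
    rw [Set.mem_inter_iff, Set.mem_preimage]
    change _ ↔ True ∧ (kpt B hb).base (IsLocalRing.closedPoint k) ∈ B.left.basicOpen s
    rw [true_and, pointOfClosedPoint_apply]
  rw [hmem, basicOpen_eq_of_affine']
  change (Scheme.ΓSpecIso (.of k)).hom _ = 0 ↔ _
  set c := (Scheme.ΓSpecIso (.of k)).hom ((kpt B hb).appLE U ⊤ (top_le_kpt_preimage B hb hbU) s)
  change c = 0 ↔ ¬ (c ∉ IsLocalRing.maximalIdeal k)
  rw [not_not, IsLocalRing.mem_maximalIdeal, mem_nonunits_iff, isUnit_iff_ne_zero, not_not]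

/-- The kernel of evaluation at `b ∈ U` is the prime ideal of `Γ(B, U)` corresponding to `b`
(Mathlib `IsAffineOpen.primeIdealOf`). [folklore] -/
theorem ker_ev_eq_primeIdealOf [IsIntegral B.left] :
    RingHom.ker (ev B hb hbU) = (hU.primeIdealOf ⟨b, hbU⟩).asIdeal := by
  obtain ⟨x, rfl⟩ : ∃ x : U, (x : B.left) = b := ⟨⟨b, hbU⟩, rfl⟩
  rw [show (⟨(x : B.left), hbU⟩ : U) = x from Subtype.ext rfl]
  haveI := hU.isLocalization_stalk x
  ext s
  have h1 : s ∈ (hU.primeIdealOf x).asIdeal ↔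
      ¬ IsUnit (algebraMap Γ(B.left, U) (B.left.presheaf.stalk (x : B.left)) s) := by
    rw [IsLocalization.AtPrime.isUnit_to_map_iff (B.left.presheaf.stalk (x : B.left))
      (hU.primeIdealOf x).asIdeal s]
    change _ ↔ ¬ (s ∉ (hU.primeIdealOf x).asIdeal)
    rw [not_not]
  rw [RingHom.mem_ker, ev_eq_zero_iff, h1]
  exact (B.left.mem_basicOpen' s x).not

end KPoint

/-! ### Transfer of linear independence along a ring isomorphism -/

/-- Linear independence of finitely many coordinate vectors is preserved by applying a ring
isomorphism to the coordinates. [folklore] -/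
theorem linearIndependent_comp_ringEquiv {F F' : Type*} [Field F] [Field F'] (σ : F ≃+* F')
    {ι : Type*} [Fintype ι] {m : ℕ} {v : ι → Fin m → F} (hv : LinearIndependent F v) :
    LinearIndependent F' fun i => σ ∘ v i := by
  rw [Fintype.linearIndependent_iff] at hv ⊢
  intro g hg i
  have h0 : ∑ i, σ.symm (g i) • v i = 0 := by
    funext j
    have hj := congr_fun hg j
    simp only [Finset.sum_apply, Pi.smul_apply, Function.comp_apply, smul_eq_mul,
      Pi.zero_apply] at hj ⊢
    apply σ.injective
    rw [map_sum, map_zero, ← hj]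
    exact Finset.sum_congr rfl fun i _ => by rw [map_mul, RingEquiv.apply_symm_apply]
  have := hv _ h0 i
  simpa using congrArg σ this

/-! ### The linear forms -/

/-- The linear form `Σⱼ yⱼ xⱼ` with coefficients in a commutative ring. [folklore] -/
def linR {R : Type u} [CommRing R] {N : ℕ} (y : Fin (N + 1) → R) : MvPolynomial (Fin (N + 1)) R :=
  ∑ j, C (y j) * X j

/-- Mapping the coefficients of `Σ yⱼ xⱼ` to a field gives the linear form `lin`. [folklore] -/
theorem map_linR {R : Type u} [CommRing R] {F : Type u} [Field F] (f : R →+* F) {N : ℕ}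
    (y : Fin (N + 1) → R) : MvPolynomial.map f (linR y) = lin (fun j => f (y j)) := by
  simp only [linR, map_sum, map_mul, map_C, map_X, lin, MvPolynomial.smul_eq_C_mul]

/-! ### Limits of lines are lines -/

open UniversalHyperplaneSection (sectionsAlgebra fromSpec_comp_hom algebraMap_sections)

/-- **Limits of lines are lines.** Let `k` be algebraically closed and `B` an integral `k`-scheme
locally of finite type, `K = k(B)`, `ι : ℙᴺ_K → ℙᴺ ×ₖ B` the generic fibre (the morphism with
components `ℙᴺ_K → ℙᴺ_k` and `ℙᴺ_K → Spec K → B`). Let `λ'` be a point of `ℙᴺ_K` at which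
`N - 1` linearly independent linear forms `μ₁, …, μ_{N-1}` over `K` vanish (the generic point of
the line `V₊(μ)`, or a point of it). Let `w ∈ ℙᴺ ×ₖ B` be a point of dimension `1` in the closure of
`ι(λ')` lying over a closed point `b` whose local ring `𝒪_{B,b}` is a principal ideal domain. Then
`pr₁ w ∈ ℙᴺ_k` is (the generic point of) a LINE: `closure {pr₁ w} = V₊(L̄₁, …, L̄_{N-1})` for
linearly independent linear forms `L̄ᵢ` over `k`. [cite: TianZong2014, proofs of Prop. 3.1 and Prop. 7.2]
[cite: Fulton1998, §10.1] -/
theorem exists_line_of_vertical [IsAlgClosed k] {N : ℕ} (hN : 1 ≤ N) (B : SchemeOver k)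
    [IsIntegral B.left] [LocallyOfFiniteType B.hom]
    (ι : Proj (homogeneousSubmodule (Fin (N + 1)) B.left.functionField) ⟶
      ((projectiveSpace N k) ⊗ B).left)
    (h₁ : ι ≫ (CartesianMonoidalCategory.fst (projectiveSpace N k) B).left =
      Proj.map (mapGraded k B.left.functionField (Fin (N + 1)))
        (irrelevant_le_map k B.left.functionField (Fin (N + 1))))
    (h₂ : ι ≫ (CartesianMonoidalCategory.snd (projectiveSpace N k) B).left =
      projToSpec (Fin (N + 1)) B.left.functionField ≫ B.left.fromSpecStalk (genericPoint B.left))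
    (μ : Fin (N - 1) → MvPolynomial (Fin (N + 1)) B.left.functionField)
    (hμli : LinearIndependent B.left.functionField μ) (hμhom : ∀ l, (μ l).IsHomogeneous 1)
    (lam : ↥(Proj (homogeneousSubmodule (Fin (N + 1)) B.left.functionField)))
    (hlam : ∀ l, μ l ∈ ProjectiveSpectrum.asHomogeneousIdeal
      (𝒜 := homogeneousSubmodule (Fin (N + 1)) B.left.functionField) lam)
    {w : ↥((projectiveSpace N k) ⊗ B).left} (hw : w ∈ closure {ι.base lam})
    (hheight : height w = 1) {b : B.left} (hb : IsClosed ({b} : Set B.left))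
    (hwb : (CartesianMonoidalCategory.snd (projectiveSpace N k) B).left.base w = b)
    (hpid : IsPrincipalIdealRing (B.left.presheaf.stalk b)) :
    ∃ L : Fin (N - 1) → MvPolynomial (Fin (N + 1)) k, LinearIndependent k L ∧
      (∀ l, (L l).IsHomogeneous 1) ∧
        closure {(CartesianMonoidalCategory.fst (projectiveSpace N k) B).left.base w} =
          ProjectiveSpectrum.zeroLocus (homogeneousSubmodule (Fin (N + 1)) k) (Set.range L) := by
  classical
  -- an affine neighbourhood `U = Spec A` of `b`
  obtain ⟨_, ⟨U, hU, rfl⟩, hbU, -⟩ :=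
    B.left.isBasis_affineOpens.exists_subset_of_mem_open (Set.mem_univ b) isOpen_univ
  haveI : Nonempty U := ⟨⟨b, hbU⟩⟩
  haveI := isScalarTower_sections_functionField B U
  -- the local ring at `b`, a PID with fraction field `B.left.functionField`, a localization of `A`
  obtain ⟨x, hx⟩ : ∃ x : U, (x : B.left) = b := ⟨⟨b, hbU⟩, rfl⟩
  subst hx
  haveI hloc : IsLocalization.AtPrime (B.left.presheaf.stalk (x : B.left)) (hU.primeIdealOf x).asIdeal :=
    hU.isLocalization_stalk x
  haveI : IsScalarTower Γ(B.left, U) (B.left.presheaf.stalk (x : B.left)) B.left.functionField :=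
    functionField_isScalarTower B.left U x
  haveI : IsPrincipalIdealRing (B.left.presheaf.stalk (x : B.left)) := hpid
  -- evaluation at `b`, the `A`-algebra structure on `k`, its kernel
  letI algk : Algebra Γ(B.left, U) k := (ev B hb hbU).toAlgebra
  have hret : ∀ c : k, algebraMap Γ(B.left, U) k (algebraMap k Γ(B.left, U) c) = c :=
    ev_scalarRingHom B hb hbU
  have hsurj : Function.Surjective (algebraMap Γ(B.left, U) k) := ev_surjective B hb hbU
  have hrange : Set.range (pt B hU).base = {(x : B.left)} := range_pt_eq B hU hb hbU
  have hker : RingHom.ker (algebraMap Γ(B.left, U) k) = (hU.primeIdealOf x).asIdeal :=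
    ker_ev_eq_primeIdealOf B hU hb hbU
  -- Step 1: the coefficient vectors of the `μ l` and their span `W`
  let vμ : Fin (N - 1) → Fin (N + 1) → B.left.functionField := fun l j => coeff (Finsupp.single j 1) (μ l)
  have hvμ : ∀ l, lin (vμ l) = μ l := fun l => (eq_lin_of_isHomogeneous_one (hμhom l)).symm
  have hvli : LinearIndependent B.left.functionField vμ := by
    refine LinearIndependent.of_comp (linMap (k := B.left.functionField) (N := N)) ?_
    have : ⇑(linMap (k := B.left.functionField) (N := N)) ∘ vμ = μ := funext fun l => hvμ l
    rw [this]
    exact hμli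
  let W : Submodule B.left.functionField (Fin (N + 1) → B.left.functionField) := Submodule.span B.left.functionField (Set.range vμ)
  have hfr : Module.finrank B.left.functionField W = N - 1 := by
    rw [finrank_span_eq_card hvli, Fintype.card_fin]
  -- Step 2: integral basis with independent reductions (Smith normal form over `𝒪_{B,b}`)
  obtain ⟨n, wv, hn, -, hspan, hli⟩ :=
    Literature.LinearAlgebra.exists_integral_basis_linearIndependent_quotient
      (O := B.left.presheaf.stalk (x : B.left)) (K := B.left.functionField) W
  have hnN : n = N - 1 := hn.symm.trans hfr |>.symm ▸ rfl
  subst hnN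
  -- each `wv i` gives a linear form over `B.left.functionField` in the homogeneous prime of `λ'`
  have hwmem : ∀ i, lin (Literature.LinearAlgebra.toFrac (B.left.presheaf.stalk (x : B.left)) B.left.functionField (wv i)) ∈
      ProjectiveSpectrum.asHomogeneousIdeal (𝒜 := homogeneousSubmodule (Fin (N + 1)) B.left.functionField) lam := by
    intro i
    have hin : Literature.LinearAlgebra.toFrac (B.left.presheaf.stalk (x : B.left)) B.left.functionField (wv i) ∈ W := by
      rw [← hspan]
      exact Submodule.subset_span ⟨i, rfl⟩
    let I : Submodule B.left.functionField (MvPolynomial (Fin (N + 1)) B.left.functionField) :=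
      ((ProjectiveSpectrum.asHomogeneousIdeal
        (𝒜 := homogeneousSubmodule (Fin (N + 1)) B.left.functionField) lam).toIdeal).restrictScalars B.left.functionField
    have hle : W ≤ I.comap (linMap (k := B.left.functionField) (N := N)) := by
      refine Submodule.span_le.mpr ?_
      rintro _ ⟨l, rfl⟩
      change lin (vμ l) ∈ (ProjectiveSpectrum.asHomogeneousIdeal
        (𝒜 := homogeneousSubmodule (Fin (N + 1)) B.left.functionField) lam).toIdeal
      rw [hvμ]
      exact hlam l
    exact hle hin
  -- Step 3: clear denominators: a common `t ∉ 𝔭_b` with `t • wv i j` integral over `A`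
  obtain ⟨t, ht⟩ := IsLocalization.exist_integer_multiples (hU.primeIdealOf x).asIdeal.primeCompl
    (Finset.univ : Finset (Fin (N - 1) × Fin (N + 1))) (fun q => wv q.1 q.2)
  choose! y hy using ht
  -- `y i j ∈ A` with `y i j = t • wv i j` in `𝒪_{B,b}`
  have hy' : ∀ i j, algebraMap Γ(B.left, U) (B.left.presheaf.stalk (x : B.left)) (y (i, j)) =
      algebraMap Γ(B.left, U) (B.left.presheaf.stalk (x : B.left)) t * wv i j := fun i j => by
    rw [hy (i, j) (Finset.mem_univ _), Algebra.smul_def]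
  -- the forms over `A`
  let μA : Fin (N - 1) → MvPolynomial (Fin (N + 1)) Γ(B.left, U) := fun i => linR fun j => y (i, j)
  -- Step 4: the forms over `A` vanish at `λ'` after scalar extension to `B.left.functionField`
  have hμAK : ∀ i, MvPolynomial.map (algebraMap Γ(B.left, U) B.left.functionField) (μA i) ∈
      ProjectiveSpectrum.asHomogeneousIdeal (𝒜 := homogeneousSubmodule (Fin (N + 1)) B.left.functionField) lam := by
    intro i
    rw [map_linR]
    have hcoef : (fun j => algebraMap Γ(B.left, U) B.left.functionField (y (i, j))) =
        fun j => algebraMap Γ(B.left, U) B.left.functionField t *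
          Literature.LinearAlgebra.toFrac (B.left.presheaf.stalk (x : B.left)) B.left.functionField (wv i) j := by
      funext j
      rw [Literature.LinearAlgebra.toFrac_apply, IsScalarTower.algebraMap_apply Γ(B.left, U)
        (B.left.presheaf.stalk (x : B.left)) B.left.functionField, hy' i j, map_mul, ← IsScalarTower.algebraMap_apply]
    rw [hcoef]
    have hsmul : lin (fun j => algebraMap Γ(B.left, U) B.left.functionField t *
        Literature.LinearAlgebra.toFrac (B.left.presheaf.stalk (x : B.left)) B.left.functionField (wv i) j) =
        C (algebraMap Γ(B.left, U) B.left.functionField t) *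
          lin (Literature.LinearAlgebra.toFrac (B.left.presheaf.stalk (x : B.left)) B.left.functionField (wv i)) := by
      simp only [lin, Finset.mul_sum, MvPolynomial.smul_eq_C_mul, map_mul, mul_assoc]
    rw [hsmul]
    exact Ideal.mul_mem_left _ _ (hwmem i)
  -- Step 5: specialise to the fibre over `b`
  have hw' : w ∈ closure {(openPiece N B hU).base ((Proj.map (mapGraded Γ(B.left, U) B.left.functionField (Fin (N + 1)))
      (irrelevant_le_map Γ(B.left, U) B.left.functionField (Fin (N + 1)))).base lam)} := by
    have hι := eq_map_comp_openPiece N B hU ι h₁ (h₂.trans (by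
      rw [fromSpecStalk_genericPoint_eq B hU]))
    rw [hι, Scheme.Hom.comp_base, TopCat.coe_comp, Function.comp_apply] at hw
    exact hw
  have hbmem : (CartesianMonoidalCategory.snd (projectiveSpace N k) B).left.base w ∈ Set.range (pt B hU).base := by
    rw [hrange, hwb]
    exact Set.mem_singleton _
  have hvan : ∀ i, MvPolynomial.map (algebraMap Γ(B.left, U) k) (μA i) ∈
      ProjectiveSpectrum.asHomogeneousIdeal (𝒜 := homogeneousSubmodule (Fin (N + 1)) k) ((CartesianMonoidalCategory.fst (projectiveSpace N k) B).left.base w) :=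
    fun i => map_mem_asHomogeneousIdeal_of_mem_closure N B hU hret lam hbmem hw' (hμAK i)
  -- Step 6: the reduced forms and their independence
  let L : Fin (N - 1) → MvPolynomial (Fin (N + 1)) k := fun i => lin fun j => algebraMap Γ(B.left, U) k (y (i, j))
  have hLeq : ∀ i, MvPolynomial.map (algebraMap Γ(B.left, U) k) (μA i) = L i := fun i => map_linR _ _
  have hLhom : ∀ i, (L i).IsHomogeneous 1 := fun i => isHomogeneous_lin _
  -- the residue isomorphisms `A/𝔭 ≃ k` (evaluation) and `A/𝔭 ≃ κ(𝒪)` (localization)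
  have h𝔭max : (hU.primeIdealOf x).asIdeal.IsMaximal :=
    hker ▸ RingHom.ker_isMaximal_of_surjective _ hsurj
  haveI := h𝔭max
  let ψ₀ : Γ(B.left, U) ⧸ (hU.primeIdealOf x).asIdeal ≃+* k :=
    (Ideal.quotEquivOfEq hker.symm).trans (RingHom.quotientKerEquivOfSurjective hsurj)
  have hψ : ∀ a : Γ(B.left, U), ψ₀ (Ideal.Quotient.mk _ a) = algebraMap Γ(B.left, U) k a := by
    intro a
    change RingHom.quotientKerEquivOfSurjective hsurj (Ideal.quotEquivOfEq hker.symm (Ideal.Quotient.mk _ a)) = _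
    rw [Ideal.quotEquivOfEq_mk]
    exact RingHom.quotientKerEquivOfSurjective_apply_mk hsurj a
  let θ : Γ(B.left, U) ⧸ (hU.primeIdealOf x).asIdeal ≃+*
      IsLocalRing.ResidueField (B.left.presheaf.stalk (x : B.left)) :=
    IsLocalization.AtPrime.equivQuotMaximalIdeal (hU.primeIdealOf x).asIdeal (B.left.presheaf.stalk (x : B.left))
  have hθ : ∀ a : Γ(B.left, U), θ (Ideal.Quotient.mk _ a) =
      IsLocalRing.residue _ (algebraMap Γ(B.left, U) (B.left.presheaf.stalk (x : B.left)) a) := fun a => rfl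
  let σ : IsLocalRing.ResidueField (B.left.presheaf.stalk (x : B.left)) ≃+* k := θ.symm.trans ψ₀
  -- the reductions of the `wv i` are independent over `κ(𝒪)`, hence (via `σ`) over `k`
  have hliO : LinearIndependent (IsLocalRing.ResidueField (B.left.presheaf.stalk (x : B.left)))
      fun i j => IsLocalRing.residue _ (wv i j) :=
    hli (IsLocalRing.maximalIdeal (B.left.presheaf.stalk (x : B.left)))
  have hlik : LinearIndependent k fun i => σ ∘ fun j => IsLocalRing.residue _ (wv i j) :=
    linearIndependent_comp_ringEquiv σ hliO
  have htk : algebraMap Γ(B.left, U) k t ≠ 0 := by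
    intro h0
    have ht𝔭 : (t : Γ(B.left, U)) ∈ RingHom.ker (algebraMap Γ(B.left, U) k) := h0
    rw [hker] at ht𝔭
    exact t.2 ht𝔭
  have hθt : θ (Ideal.Quotient.mk _ (t : Γ(B.left, U))) ≠ 0 := by
    rw [RingEquiv.map_ne_zero_iff, Ne, Ideal.Quotient.eq_zero_iff_mem]
    exact t.2
  -- `ev (y i j) = ev t * σ (wv i j mod 𝔪𝒪)`
  have hred : ∀ i j, algebraMap Γ(B.left, U) k (y (i, j)) = algebraMap Γ(B.left, U) k t *
      σ (IsLocalRing.residue _ (wv i j)) := by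
    intro i j
    -- in `κ(𝒪)`: `y i j = t * wv i j`
    have h1 : IsLocalRing.residue _ (wv i j) =
        (θ (Ideal.Quotient.mk _ (t : Γ(B.left, U))))⁻¹ * θ (Ideal.Quotient.mk _ (y (i, j))) := by
      rw [hθ, hθ, hy' i j, map_mul, ← mul_assoc, inv_mul_cancel₀ (by rw [← hθ]; exact hθt), one_mul]
    rw [h1, map_mul, map_inv₀]
    change _ = _ * ((ψ₀ (θ.symm (θ _)))⁻¹ * ψ₀ (θ.symm (θ _)))
    rw [RingEquiv.symm_apply_apply, RingEquiv.symm_apply_apply, hψ, hψ, ← mul_assoc,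
      mul_inv_cancel₀ htk, one_mul]
  have hLli : LinearIndependent k L := by
    have hcoords : LinearIndependent k fun i j => algebraMap Γ(B.left, U) k (y (i, j)) := by
      have h := hlik.units_smul fun _ => Units.mk0 _ htk
      convert h using 1
      funext i j
      simp only [Pi.smul_apply', Units.smul_mk0, Pi.smul_apply, smul_eq_mul, Function.comp_apply]
      exact hred i j
    exact hcoords.map' (linMap (k := k) (N := N)) ker_linMap
  -- Step 7: `((CartesianMonoidalCategory.fst (projectiveSpace N k) B).left.base w)` lies on the line `V₊(L)` and has dimension one, so it is its generic point
  have hpmem : ((CartesianMonoidalCategory.fst (projectiveSpace N k) B).left.base w) ∈ ProjectiveSpectrum.zeroLocus (homogeneousSubmodule (Fin (N + 1)) k) (Set.range L) := by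
    rintro _ ⟨i, rfl⟩
    rw [← hLeq]
    exact hvan i
  have hclosed : IsClosed (Set.range (pt B hU).base) := by rw [hrange]; exact hb
  haveI := isClosedImmersion_slice N B hU hsurj hclosed
  have hwp : w = slice N B hU ((CartesianMonoidalCategory.fst (projectiveSpace N k) B).left.base w) := eq_slice_fst_of_snd_mem N B hU hret hbmem
  have hheightp : height ((CartesianMonoidalCategory.fst (projectiveSpace N k) B).left.base w) = 1 := by
    rw [← height_base_eq_of_isClosedImmersion' (slice N B hU) ((CartesianMonoidalCategory.fst (projectiveSpace N k) B).left.base w), ← hwp, hheight]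
  have ht : N - 1 ≤ N := Nat.sub_le N 1
  have hpeq : ((CartesianMonoidalCategory.fst (projectiveSpace N k) B).left.base w) = linearSubspacePoint L hLli hLhom ht := by
    by_contra hne
    have hlt := height_lt_of_mem_zeroLocus L hLli hLhom ht hpmem hne
    rw [hheightp, show N - (N - 1) = 1 by omega, Nat.cast_one] at hlt
    exact lt_irrefl _ hlt
  refine ⟨L, hLli, hLhom, ?_⟩
  rw [hpeq, closure_linearSubspacePoint]

end ProjFamily

end Literature.AlgebraicGeometry.Motives

end
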